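import Summits.AtomisticToContinuum.FouriersLaw.Theorems.EmbeddedDrudeMourreDrudeDissolutionStubPencilFrameworkClustering
import Summits.AtomisticToContinuum.FouriersLaw.Theorems.EmbeddedDrudeMourreDrudeDissolutionStubRichFrameworkTransfer

/-!
# Stub F `stub_richFramework` of line `kinetic-polymer-gas-on-the-time-axis`, part R-M: the
multi-time monomials of the local polynomials along the Buttà–Marchioro flow — moments and
weighted `L¹`-locality with a summable rate
(crux `EmbeddedDrudeMourre.DrudeDissolution`, stmt-AtomisticToContinuum-12593; `--supports` file)

The observables of the rich datum are the span of the multiplicative monoid generated by the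
flow-orbit `𝒪 = {u ∘ φ_s : u ∈ 𝒫, s ∈ ℝ}` of the local polynomials (`𝒫 = Algebra.adjoin ℝ {q_x, p_x}`):
the MULTI-TIME MONOMIALS `M = Π_i (u_i ∘ φ_{s_i})`. For every such `M` we prove, by induction on
`Submonoid.closure 𝒪` (`richFramework_monomials`, registered helper):

* `M` is measurable with all moments finite;
* there are a locality margin `K`, a weight level `k ≥ 2` and box-local approximants `h t n`
  (reading `[-(n+K), n+K]`; for a generator `u ∘ φ_s`: `u ∘ T^{Λ_{0,n}}_{s+t}`, the severed flow;
  products for products) of the time-translates `M ∘ φ_t`, with moments bounded uniformly in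
  `(t, n)`, such that for every moment budget `B` there is a summable rate `δ` with the WEIGHTED
  `L¹`-locality estimate `∫ |M ∘ φ_t - h t n| |W| dμ ≤ δ n` for all `|t| ≤ 1`, all `n` and all
  measurable weights `W` with `∫ |W|^k ≤ B`.

The generator case is the fixed-time `L²` locality of part F-L2 of the sibling line's stub F
(`pencilFramework_localityB`) and Cauchy–Schwarz; the product case is the telescoping
`M₁M₂ - h₁h₂ = (M₁ - h₁)M₂ + h₁(M₂ - h₂)`, absorbing the extra factor into the weight (whence the
doubling of the level `k`). Also: continuity of `t ↦ M(φ_t σ)` on the carrier.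
-/

noncomputable section

open MeasureTheory ProbabilityTheory Set Filter Topology Function Real
open scoped InnerProductSpace ENNReal BigOperators
open Literature.MathematicalPhysics.KineticTheory
open Literature.MathematicalPhysics.KineticTheory.HeatConduction
open Summit.AtomisticToContinuum.FouriersLaw.Theorems.DrudeDissolution.GramPencilHarmonicChaos

namespace Summit.AtomisticToContinuum.FouriersLaw.Theorems.DrudeDissolution.KineticPolymerGasOnTheTimeAxis

variable {P : OscillatorChain}

/-- Lower moments from higher ones under a probability measure: `|W|^j ∈ L¹` if `|W|^k ∈ L¹`,
`j ≤ k`. [folklore] -/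
theorem integrable_abs_pow_of_le {μ : Measure ChainConfig} [IsProbabilityMeasure μ]
    {W : ChainConfig → ℝ} (hWm : Measurable W) {j k : ℕ} (hjk : j ≤ k)
    (hW : Integrable (fun σ => |W σ| ^ k) μ) : Integrable (fun σ => |W σ| ^ j) μ :=
  Integrable.mono' ((integrable_const (1 : ℝ)).add hW) ((hWm.abs.pow_const j).aestronglyMeasurable)
    (Eventually.of_forall fun σ => by
      rw [Real.norm_eq_abs, abs_of_nonneg (pow_nonneg (abs_nonneg _) _)]
      exact pow_le_one_add_pow (abs_nonneg _) hjk)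

/-- Moments of a product from the doubled moments of the factors. [folklore] -/
theorem integrable_abs_mul_pow {μ : Measure ChainConfig} {f g : ChainConfig → ℝ} (hfm : Measurable f)
    (hgm : Measurable g) (j : ℕ) (hf : Integrable (fun σ => |f σ| ^ (2 * j)) μ)
    (hg : Integrable (fun σ => |g σ| ^ (2 * j)) μ) :
    Integrable (fun σ => |f σ * g σ| ^ j) μ ∧
      ∫ σ, |f σ * g σ| ^ j ∂μ ≤ (∫ σ, |f σ| ^ (2 * j) ∂μ) + ∫ σ, |g σ| ^ (2 * j) ∂μ := by
  have hpt : ∀ σ, |f σ * g σ| ^ j ≤ |f σ| ^ (2 * j) + |g σ| ^ (2 * j) := fun σ => by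
    rw [abs_mul]; exact mul_pow_le_pow_add_pow (abs_nonneg _) (abs_nonneg _) j
  have hint : Integrable (fun σ => |f σ * g σ| ^ j) μ :=
    Integrable.mono' (hf.add hg) (((hfm.mul hgm).abs.pow_const j).aestronglyMeasurable)
      (Eventually.of_forall fun σ => by
        rw [Real.norm_eq_abs, abs_of_nonneg (pow_nonneg (abs_nonneg _) _)]; exact hpt σ)
  exact ⟨hint, (integral_mono hint (hf.add hg) hpt).trans (le_of_eq (integral_add hf hg))⟩

/-! ## The three cases of the induction -/

/-- **Base case `M = 1`** of the weighted locality package (approximants `1`, rate `0`). [folklore] -/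
theorem richMonomial_one (D : InfiniteChainDynamics P) (μ : Measure ChainConfig) [IsProbabilityMeasure μ] :
    (Measurable (1 : (ℤ → ℝ × ℝ) → ℝ) ∧ (∀ j : ℕ, MeasureTheory.Integrable (fun σ => |(1 : (ℤ → ℝ × ℝ) → ℝ) σ| ^ j) μ) ∧ ∃ (K k : ℕ) (h : ℝ → ℕ → (ℤ → ℝ × ℝ) → ℝ), 2 ≤ k ∧ (∀ (t : ℝ) (n : ℕ), DependsOn (h t n) (Set.Icc (-((n + K : ℕ) : ℤ)) (n + K : ℕ)) ∧ Measurable (h t n)) ∧ (∀ j : ℕ, ∃ A : ℝ, ∀ (t : ℝ) (n : ℕ), MeasureTheory.Integrable (fun σ => |h t n σ| ^ j) μ ∧ MeasureTheory.integral μ (fun σ => |h t n σ| ^ j) ≤ A) ∧ (∀ B : ℝ, ∃ δ : ℕ → ℝ, (∀ n, 0 ≤ δ n) ∧ Summable δ ∧ ∀ t : ℝ, |t| ≤ 1 → ∀ (n : ℕ) (W : (ℤ → ℝ × ℝ) → ℝ), Measurable W → MeasureTheory.Integrable (fun σ => |W σ| ^ k) μ → MeasureTheory.integral μ (fun σ =>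 |W σ| ^ k) ≤ B → MeasureTheory.integral μ (fun σ => |(1 : (ℤ → ℝ × ℝ) → ℝ) (D.flow t σ) - h t n σ| * |W σ|) ≤ δ n)) := by
  refine ⟨measurable_const, fun j => ?_, 0, 2, fun _ _ _ => 1, le_rfl, fun t n => ⟨fun _ _ _ => rfl,
    measurable_const⟩, fun j => ⟨1, fun t n => ?_⟩, fun B => ⟨fun _ => 0, fun _ => le_rfl, summable_zero,
    fun t _ n W _ _ _ => ?_⟩⟩
  · simp only [Pi.one_apply, abs_one, one_pow]; exact integrable_const _
  · simp only [abs_one, one_pow, integral_const, probReal_univ, smul_eq_mul, mul_one]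
    exact ⟨integrable_const _, le_rfl⟩
  · simp only [Pi.one_apply, sub_self, abs_zero, zero_mul, integral_zero, le_refl]

/-- **Product case** of the weighted locality package: approximants `h₁ h₂`, margin `max K₁ K₂`,
level `2 max(k₁, k₂)`; `|M₁M₂ - h₁h₂| |W| ≤ |M₁ - h₁| |M₂ W| + |M₂ - h₂| |h₁ W|`, the two new
weights having `kᵢ`-th moments bounded by a budget depending only on `B` and the moments of
`M₂`, `h₁`. [folklore] -/
theorem richMonomial_mul (D : InfiniteChainDynamics P) (μ : Measure ChainConfig) [IsProbabilityMeasure μ]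
    (hflow : ∀ t, MeasurePreserving (D.flow t) μ μ) {M₁ M₂ : ChainConfig → ℝ}
    (h₁ : (Measurable M₁ ∧ (∀ j : ℕ, MeasureTheory.Integrable (fun σ => |M₁ σ| ^ j) μ) ∧ ∃ (K k : ℕ) (h : ℝ → ℕ → (ℤ → ℝ × ℝ) → ℝ), 2 ≤ k ∧ (∀ (t : ℝ) (n : ℕ), DependsOn (h t n) (Set.Icc (-((n + K : ℕ) : ℤ)) (n + K : ℕ)) ∧ Measurable (h t n)) ∧ (∀ j : ℕ, ∃ A : ℝ, ∀ (t : ℝ) (n : ℕ), MeasureTheory.Integrable (fun σ => |h t n σ| ^ j) μ ∧ MeasureTheory.integral μ (fun σ => |h t n σ| ^ j) ≤ A) ∧ (∀ B : ℝ, ∃ δ : ℕ → ℝ, (∀ n, 0 ≤ δ n) ∧ Summable δ ∧ ∀ t : ℝ, |t| ≤ 1 → ∀ (n : ℕ) (W : (ℤ → ℝ × ℝ) → ℝ), Measurable W → MeasureTheory.Integrable (fun σ => |W σ| ^ k) μ → MeasureTheory.integral μ (fun σ => |W σ| ^ k) ≤ B → MeasureTheory.integral μ (fun σ => |M₁ (D.flow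 t σ) - h t n σ| * |W σ|) ≤ δ n)))
    (h₂ : (Measurable M₂ ∧ (∀ j : ℕ, MeasureTheory.Integrable (fun σ => |M₂ σ| ^ j) μ) ∧ ∃ (K k : ℕ) (h : ℝ → ℕ → (ℤ → ℝ × ℝ) → ℝ), 2 ≤ k ∧ (∀ (t : ℝ) (n : ℕ), DependsOn (h t n) (Set.Icc (-((n + K : ℕ) : ℤ)) (n + K : ℕ)) ∧ Measurable (h t n)) ∧ (∀ j : ℕ, ∃ A : ℝ, ∀ (t : ℝ) (n : ℕ), MeasureTheory.Integrable (fun σ => |h t n σ| ^ j) μ ∧ MeasureTheory.integral μ (fun σ => |h t n σ| ^ j) ≤ A) ∧ (∀ B : ℝ, ∃ δ : ℕ → ℝ, (∀ n, 0 ≤ δ n) ∧ Summable δ ∧ ∀ t : ℝ, |t| ≤ 1 → ∀ (n : ℕ) (W : (ℤ → ℝ × ℝ) → ℝ), Measurable W → MeasureTheory.Integrable (fun σ => |W σ| ^ k) μ → MeasureTheory.integral μ (fun σ => |W σ| ^ k) ≤ B → MeasureTheory.integral μ (fun σ => |M₂ (D.flow t σ) - h t n σ| * |W σ|) ≤ δ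 n))) :
    (Measurable (M₁ * M₂) ∧ (∀ j : ℕ, MeasureTheory.Integrable (fun σ => |(M₁ * M₂) σ| ^ j) μ) ∧ ∃ (K k : ℕ) (h : ℝ → ℕ → (ℤ → ℝ × ℝ) → ℝ), 2 ≤ k ∧ (∀ (t : ℝ) (n : ℕ), DependsOn (h t n) (Set.Icc (-((n + K : ℕ) : ℤ)) (n + K : ℕ)) ∧ Measurable (h t n)) ∧ (∀ j : ℕ, ∃ A : ℝ, ∀ (t : ℝ) (n : ℕ), MeasureTheory.Integrable (fun σ => |h t n σ| ^ j) μ ∧ MeasureTheory.integral μ (fun σ => |h t n σ| ^ j) ≤ A) ∧ (∀ B : ℝ, ∃ δ : ℕ → ℝ, (∀ n, 0 ≤ δ n) ∧ Summable δ ∧ ∀ t : ℝ, |t| ≤ 1 → ∀ (n : ℕ) (W : (ℤ → ℝ × ℝ) → ℝ), Measurable W → MeasureTheory.Integrable (fun σ => |W σ| ^ k) μ → MeasureTheory.integral μ (fun σ => |W σ| ^ k) ≤ B → MeasureTheory.integral μ (fun σ => |(M₁ * M₂) (D.flow t σ) - h t n σ| * |W σ|) ≤ δ n)) := by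
  obtain ⟨hm1, hmom1, K₁, k₁, g₁, hk₁, hloc1, hA1, hδ1⟩ := h₁
  obtain ⟨hm2, hmom2, K₂, k₂, g₂, hk₂, hloc2, hA2, hδ2⟩ := h₂
  refine ⟨hm1.mul hm2, fun j => ?_, max K₁ K₂, 2 * max k₁ k₂, fun t n σ => g₁ t n σ * g₂ t n σ,
    by omega, fun t n => ⟨?_, (hloc1 t n).2.mul (hloc2 t n).2⟩, fun j => ?_, fun B => ?_⟩
  · -- moments of `M₁ M₂`
    exact (integrable_abs_mul_pow hm1 hm2 j (hmom1 _) (hmom2 _)).1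
  · -- locality of `g₁ g₂`
    intro σ σ' hσ
    have e1 := (hloc1 t n).1 (fun i hi => hσ i (Icc_subset_Icc (by push_cast; omega) (by push_cast; omega) hi))
    have e2 := (hloc2 t n).1 (fun i hi => hσ i (Icc_subset_Icc (by push_cast; omega) (by push_cast; omega) hi))
    simp only [e1, e2]
  · -- moments of `g₁ g₂`, uniformly in `(t, n)`
    obtain ⟨A₁, hA₁⟩ := hA1 (2 * j)
    obtain ⟨A₂, hA₂⟩ := hA2 (2 * j)
    refine ⟨A₁ + A₂, fun t n => ?_⟩
    obtain ⟨hi, hle⟩ := integrable_abs_mul_pow (hloc1 t n).2 (hloc2 t n).2 j (hA₁ t n).1 (hA₂ t n).1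
    exact ⟨hi, hle.trans (add_le_add (hA₁ t n).2 (hA₂ t n).2)⟩
  · -- the weighted locality estimate
    obtain ⟨δ₁, hδ₁0, hδ₁s, hδ₁⟩ := hδ1 ((∫ σ, |M₂ σ| ^ (2 * k₁) ∂μ) + (1 + B))
    obtain ⟨A, hA⟩ := hA1 (2 * k₂)
    obtain ⟨δ₂, hδ₂0, hδ₂s, hδ₂⟩ := hδ2 (A + (1 + B))
    refine ⟨fun n => δ₁ n + δ₂ n, fun n => add_nonneg (hδ₁0 n) (hδ₂0 n), hδ₁s.add hδ₂s, ?_⟩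
    intro t ht n W hWm hWk hWB
    have hk : 2 ≤ 2 * max k₁ k₂ := by omega
    have hφm : Measurable (D.flow t) := (hflow t).measurable
    have hM1t : Measurable fun σ => M₁ (D.flow t σ) := hm1.comp hφm
    have hM2t : Measurable fun σ => M₂ (D.flow t σ) := hm2.comp hφm
    have hmomt : ∀ j, Integrable (fun σ => |M₂ (D.flow t σ)| ^ j) μ ∧
        ∫ σ, |M₂ (D.flow t σ)| ^ j ∂μ = ∫ σ, |M₂ σ| ^ j ∂μ := fun j =>
      ⟨(hflow t).integrable_comp_of_integrable (hmom2 j),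
        integral_comp_eq_of_measurePreserving (hflow t) (F := fun σ => |M₂ σ| ^ j)
          (hmom2 j).aestronglyMeasurable⟩
    have hmom1t : ∀ j, Integrable (fun σ => |M₁ (D.flow t σ)| ^ j) μ := fun j =>
      (hflow t).integrable_comp_of_integrable (hmom1 j)
    -- the two weights
    obtain ⟨hW1i, hW1le⟩ := integral_abs_mul_pow_le hM2t hWm (k₁ := k₁) (k := 2 * max k₁ k₂) (by omega)
      (hmomt _).1 hWk
    obtain ⟨hW2i, hW2le⟩ := integral_abs_mul_pow_le (hloc1 t n).2 hWm (k₁ := k₂) (k := 2 * max k₁ k₂)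
      (by omega) (hA t n).1 hWk
    have e1 := hδ₁ t ht n (fun σ => M₂ (D.flow t σ) * W σ) (hM2t.mul hWm) hW1i
      (hW1le.trans (by rw [(hmomt _).2]; linarith))
    have e2 := hδ₂ t ht n (fun σ => g₁ t n σ * W σ) ((hloc1 t n).2.mul hWm) hW2i
      (hW2le.trans (by linarith [(hA t n).2]))
    -- integrability of the two majorants
    have hW2 : Integrable (fun σ => |W σ| ^ 2) μ := integrable_abs_pow_of_le hWm hk hWk
    obtain ⟨A4, hA4⟩ := hA1 4
    obtain ⟨A4', hA4'⟩ := hA2 4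
    have hi1 : Integrable (fun σ => |M₁ (D.flow t σ) - g₁ t n σ| * |M₂ (D.flow t σ) * W σ|) μ :=
      integrable_abs_sub_mul_abs_mul hM1t hM2t (hloc1 t n).2 hWm (hmom1t 4) (hmomt 4).1 (hA4 t n).1 hW2
    have hi2 : Integrable (fun σ => |M₂ (D.flow t σ) - g₂ t n σ| * |g₁ t n σ * W σ|) μ :=
      integrable_abs_sub_mul_abs_mul hM2t (hloc1 t n).2 (hloc2 t n).2 hWm (hmomt 4).1 (hA4 t n).1
        (hA4' t n).1 hW2
    -- pointwise telescoping
    have hpt : ∀ σ, |(M₁ * M₂) (D.flow t σ) - g₁ t n σ * g₂ t n σ| * |W σ| ≤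
        |M₁ (D.flow t σ) - g₁ t n σ| * |M₂ (D.flow t σ) * W σ| +
          |M₂ (D.flow t σ) - g₂ t n σ| * |g₁ t n σ * W σ| := by
      intro σ
      simp only [Pi.mul_apply]
      have e : M₁ (D.flow t σ) * M₂ (D.flow t σ) - g₁ t n σ * g₂ t n σ =
          (M₁ (D.flow t σ) - g₁ t n σ) * M₂ (D.flow t σ) + g₁ t n σ * (M₂ (D.flow t σ) - g₂ t n σ) := by
        ring
      rw [e]
      calc |(M₁ (D.flow t σ) - g₁ t n σ) * M₂ (D.flow t σ) + g₁ t n σ * (M₂ (D.flow t σ) - g₂ t n σ)| * |W σ|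
          ≤ (|(M₁ (D.flow t σ) - g₁ t n σ) * M₂ (D.flow t σ)| + |g₁ t n σ * (M₂ (D.flow t σ) - g₂ t n σ)|) *
              |W σ| := mul_le_mul_of_nonneg_right (abs_add_le _ _) (abs_nonneg _)
        _ = _ := by simp only [abs_mul]; ring
    calc ∫ σ, |(M₁ * M₂) (D.flow t σ) - g₁ t n σ * g₂ t n σ| * |W σ| ∂μ
        ≤ ∫ σ, (|M₁ (D.flow t σ) - g₁ t n σ| * |M₂ (D.flow t σ) * W σ| +
            |M₂ (D.flow t σ) - g₂ t n σ| * |g₁ t n σ * W σ|) ∂μ :=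
          integral_mono_of_nonneg (Eventually.of_forall fun σ => mul_nonneg (abs_nonneg _) (abs_nonneg _))
            (hi1.add hi2) (Eventually.of_forall hpt)
      _ = (∫ σ, |M₁ (D.flow t σ) - g₁ t n σ| * |M₂ (D.flow t σ) * W σ| ∂μ) +
            ∫ σ, |M₂ (D.flow t σ) - g₂ t n σ| * |g₁ t n σ * W σ| ∂μ := integral_add hi1 hi2
      _ ≤ δ₁ n + δ₂ n := add_le_add e1 e2

/-- **Generator case** `M = u ∘ φ_s` (`u ∈ 𝒫`) of the weighted locality package, for the canonical
Buttà–Marchioro dynamics of `pinnedChain ω₂ lam β γ` (`ω₂ > 0`, `lam, β ≥ 0`) and a superstable DLR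
state: approximants `u ∘ T^{Λ_{0,n}}_{s+t}` (margin `k_u + 1`, level `2`), moments by invariance of
`μ` under the severed flows, the estimate by the fixed-time `L²` locality `pencilFramework_localityB`
on the time window `[-(|s|+1), |s|+1]` and Cauchy–Schwarz. [cite: ButtaMarchioro2016, §3 eqs. (3.7), (3.14)–(3.16)] -/
theorem richMonomial_mem {ω₂ lam β : ℝ} (γ : ℝ) (hω : 0 < ω₂) (hl : 0 ≤ lam) (hβ : 0 ≤ β) {T : ℝ}
    (hT : 0 < T) (D : InfiniteChainDynamics (pinnedChain ω₂ lam β γ))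
    (hcar : D.carrier = (pinnedChain ω₂ lam β γ).bmGood) (hmeas : ∀ t : ℝ, Measurable (D.flow t))
    (hgrp : ∀ t s : ℝ, D.flow (t + s) = D.flow t ∘ D.flow s) (μ : Measure ChainConfig)
    [IsProbabilityMeasure μ] (hG : (pinnedChain ω₂ lam β γ).IsChainGibbsMeasure T μ)
    (hS : IsShiftInvariant μ) (hss : (pinnedChain ω₂ lam β γ).HasSuperstabilityEstimate μ)
    (hD : D.PreservesMeasure μ) {u : ChainConfig → ℝ}
    (hu : u ∈ Algebra.adjoin ℝ (Set.range fun xc : ℤ × Bool => fun σ : ChainConfig =>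
      if xc.2 then (σ xc.1).2 else (σ xc.1).1)) (s : ℝ) :
    (Measurable (u ∘ D.flow s) ∧ (∀ j : ℕ, MeasureTheory.Integrable (fun σ => |(u ∘ D.flow s) σ| ^ j) μ) ∧ ∃ (K k : ℕ) (h : ℝ → ℕ → (ℤ → ℝ × ℝ) → ℝ), 2 ≤ k ∧ (∀ (t : ℝ) (n : ℕ), DependsOn (h t n) (Set.Icc (-((n + K : ℕ) : ℤ)) (n + K : ℕ)) ∧ Measurable (h t n)) ∧ (∀ j : ℕ, ∃ A : ℝ, ∀ (t : ℝ) (n : ℕ), MeasureTheory.Integrable (fun σ => |h t n σ| ^ j) μ ∧ MeasureTheory.integral μ (fun σ => |h t n σ| ^ j) ≤ A) ∧ (∀ B : ℝ, ∃ δ : ℕ → ℝ, (∀ n, 0 ≤ δ n) ∧ Summable δ ∧ ∀ t : ℝ, |t| ≤ 1 → ∀ (n : ℕ) (W : (ℤ → ℝ × ℝ) → ℝ), Measurable W → MeasureTheory.Integrable (fun σ => |W σ| ^ k) μ → MeasureTheory.integral μ (fun σ => |W σ| ^ k) ≤ B → MeasureTheory.integral μ (fun σ => |(u ∘ D.flow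 s) (D.flow t σ) - h t n σ| * |W σ|) ≤ δ n)) := by
  obtain ⟨s₁, hs₁, hU1⟩ := exists_isEvenPolyOfDegree_U_pinnedChain β γ hω hl
  obtain ⟨s₂, hs₂, hV1⟩ := exists_isEvenPolyOfDegree_V_pinnedChain ω₂ lam γ hβ
  have hU : ContDiff ℝ 2 (pinnedChain ω₂ lam β γ).U := hU1.contDiff_two
  have hV : ContDiff ℝ 2 (pinnedChain ω₂ lam β γ).V := hV1.contDiff_two
  have hB1 : (pinnedChain ω₂ lam β γ).CondB1 := OscillatorChain.condB1_pinnedChain hω.le hl hβ γ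
  have hsev : ∀ (n : ℕ) (t : ℝ), MeasurePreserving
      (OscillatorChain.severedFlow hB1 (Finset.Icc ((0 : ℤ) - n) ((0 : ℤ) + n)) t) μ μ := fun n t =>
    OscillatorChain.measurePreserving_severedFlow_of_isChainGibbsMeasure hU hV hB1 _ hG t
  obtain ⟨hum, hmom⟩ := measurable_and_integrable_pow_of_mem_polyObs γ hω hl hβ hT hG hS hu
  obtain ⟨-, hu2, hu4⟩ := moments_of_mem_polyObs γ hω hl hβ hT hG hS hu
  obtain ⟨ku, Cu, du, hCu, hdep, hLip⟩ := pencilFramework_polynomials u hu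
  obtain ⟨ε, hε0, hε, hmain⟩ := pencilFramework_localityB (pinnedChain ω₂ lam β γ) s₁ s₂ D hs₁ hs₂
    hU1 hV1 hcar hB1 μ hss hD hsev ku u hum hdep hu2 hu4 Cu du hCu
    (fun σ σ' R δ hR hδ0 hδ1 h => (hLip σ σ' R δ hR hδ0 hδ1 h).1) (|s| + 1) (by positivity)
  refine ⟨hum.comp (hmeas s), fun j => (hD.2 s).integrable_comp_of_integrable (hmom j), ku + 1, 2,
    fun t n => u ∘ OscillatorChain.severedFlow hB1 (Finset.Icc ((0 : ℤ) - n) ((0 : ℤ) + n)) (s + t),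
    le_rfl, fun t n => ⟨?_, hum.comp (OscillatorChain.measurable_severedFlow hB1 _ hU hV (s + t))⟩,
    fun j => ⟨∫ σ, |u σ| ^ j ∂μ, fun t n => ⟨(hsev n (s + t)).integrable_comp_of_integrable (hmom j),
      le_of_eq (integral_comp_eq_of_measurePreserving (hsev n (s + t)) (F := fun σ => |u σ| ^ j)
        (hmom j).aestronglyMeasurable)⟩⟩, fun B => ?_⟩
  · -- locality of the approximant
    refine (dependsOn_comp_severedFlow_box hU hV hB1 hdep n (s + t)).mono fun i hi => ?_
    simp only [mem_Icc, Nat.cast_add, Nat.cast_one] at hi ⊢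
    constructor <;> omega
  · -- the weighted estimate: Cauchy–Schwarz and `L²` locality on the window `|s + t| ≤ |s| + 1`
    refine ⟨fun n => ε n * Real.sqrt B, fun n => mul_nonneg (hε0 n) (Real.sqrt_nonneg _),
      hε.mul_right _, fun t ht n W hWm hWk hWB => ?_⟩
    have ht' : |s + t| ≤ |s| + 1 := (abs_add_le _ _).trans (by linarith)
    obtain ⟨-, -, hg2, herr⟩ := hmain (s + t) ht' n
    have e : ∀ σ, (u ∘ D.flow s) (D.flow t σ) = u (D.flow (s + t) σ) := fun σ => by
      rw [hgrp s t]; rfl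
    simp only [e]
    have hf2 : MemLp (fun σ => u (D.flow (s + t) σ) -
        u (OscillatorChain.severedFlow hB1 (Finset.Icc ((0 : ℤ) - n) ((0 : ℤ) + n)) (s + t) σ)) 2 μ :=
      (hu2.comp_measurePreserving (hD.2 (s + t))).sub hg2
    calc ∫ σ, |u (D.flow (s + t) σ) -
          u (OscillatorChain.severedFlow hB1 (Finset.Icc ((0 : ℤ) - n) ((0 : ℤ) + n)) (s + t) σ)| * |W σ| ∂μ
        ≤ Real.sqrt (∫ σ, (u (D.flow (s + t) σ) -
            u (OscillatorChain.severedFlow hB1 (Finset.Icc ((0 : ℤ) - n) ((0 : ℤ) + n)) (s + t) σ)) ^ 2 ∂μ) *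
            Real.sqrt (∫ σ, |W σ| ^ 2 ∂μ) := integral_abs_mul_abs_le_sqrt hf2 hWm hWk
      _ ≤ ε n * Real.sqrt B :=
          mul_le_mul (herr) (Real.sqrt_le_sqrt hWB) (Real.sqrt_nonneg _) (hε0 n)

/-! ## The package for all multi-time monomials -/

/-- **Part R-M of stub F (registered helper): moments and weighted `L¹`-locality of the multi-time
monomials.** For `pinnedChain ω₂ lam β γ` (`ω₂ > 0`, `lam, β ≥ 0`), `T > 0`, the canonical
Buttà–Marchioro dynamics `D` (carrier `bmGood`, measurable flow, identity off `bmGood`, global group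
law) and a shift-invariant superstable DLR state `μ` at `T`: every element `M` of the multiplicative
monoid generated by `{u ∘ φ_s : u ∈ 𝒫, s ∈ ℝ}` is measurable with all moments finite, and admits a
margin `K`, a level `k ≥ 2` and box-local approximants `h t n` of `M ∘ φ_t` (reading
`[-(n+K), n+K]`, moments bounded uniformly in `(t, n)`) such that for every budget `B` some summable
`δ ≥ 0` bounds `∫ |M ∘ φ_t - h t n| |W| dμ ≤ δ n` for all `|t| ≤ 1`, `n`, and measurable `W` with
`∫ |W|^k dμ ≤ B`. Induction on the monoid closure: `richMonomial_mem/one/mul`.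
[cite: ButtaMarchioro2016, §3 eqs. (3.7), (3.14)–(3.16)] -/
theorem richFramework_monomials : ∀ (ω₂ lam β γ : ℝ), 0 < ω₂ → 0 ≤ lam → 0 ≤ β → ∀ T : ℝ, 0 < T → ∀ D : Literature.MathematicalPhysics.KineticTheory.HeatConduction.InfiniteChainDynamics (Literature.MathematicalPhysics.KineticTheory.HeatConduction.pinnedChain ω₂ lam β γ), D.carrier = (Literature.MathematicalPhysics.KineticTheory.HeatConduction.pinnedChain ω₂ lam β γ).bmGood → (∀ t : ℝ, Measurable (D.flow t)) → (∀ (t : ℝ) (σ : ℤ → ℝ × ℝ), σ ∉ (Literature.MathematicalPhysics.KineticTheory.HeatConduction.pinnedChain ω₂ lam β γ).bmGood → D.flow t σ = σ) → (∀ t s : ℝ, D.flow (t + s) = D.flow t ∘ D.flow s) → ∀ (μ : MeasureTheory.Measure (ℤ → ℝ × ℝ)), (Literature.MathematicalPhysics.KineticTheory.HeatConduction.pinnedChain ω₂ lam β γ).IsChainGibbsMeasure T μ → Literature.MathematicalPhysics.KineticTheory.HeatConduction.IsShiftInvariant μ → (Literature.MathematicalPhysics.KineticTheory.HeatConduction.pinnedChain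 ω₂ lam β γ).HasSuperstabilityEstimate μ → ∀ M ∈ Submonoid.closure {w : (ℤ → ℝ × ℝ) → ℝ | ∃ u ∈ Algebra.adjoin ℝ (Set.range fun xc : ℤ × Bool => fun σ : Literature.MathematicalPhysics.KineticTheory.HeatConduction.ChainConfig => if xc.2 then (σ xc.1).2 else (σ xc.1).1), ∃ s : ℝ, w = u ∘ D.flow s}, (Measurable M ∧ (∀ j : ℕ, MeasureTheory.Integrable (fun σ => |M σ| ^ j) μ) ∧ ∃ (K k : ℕ) (h : ℝ → ℕ → (ℤ → ℝ × ℝ) → ℝ), 2 ≤ k ∧ (∀ (t : ℝ) (n : ℕ), DependsOn (h t n) (Set.Icc (-((n + K : ℕ) : ℤ)) (n + K : ℕ)) ∧ Measurable (h t n)) ∧ (∀ j : ℕ, ∃ A : ℝ, ∀ (t : ℝ) (n : ℕ), MeasureTheory.Integrable (fun σ => |h t n σ| ^ j) μ ∧ MeasureTheory.integral μ (fun σ => |h t n σ| ^ j) ≤ A) ∧ (∀ B : ℝ, ∃ δ : ℕ → ℝ, (∀ n, 0 ≤ δ n) ∧ Summable δ ∧ ∀ t : ℝ, |t| ≤ 1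 → ∀ (n : ℕ) (W : (ℤ → ℝ × ℝ) → ℝ), Measurable W → MeasureTheory.Integrable (fun σ => |W σ| ^ k) μ → MeasureTheory.integral μ (fun σ => |W σ| ^ k) ≤ B → MeasureTheory.integral μ (fun σ => |M (D.flow t σ) - h t n σ| * |W σ|) ≤ δ n)) := by
  intro ω₂ lam β γ hω hl hβ T hT D hcar hmeas hid hgrp μ hG hS hss M hM
  haveI : IsProbabilityMeasure μ := hG.isProbabilityMeasure
  obtain ⟨s₁, hs₁, hU1⟩ := exists_isEvenPolyOfDegree_U_pinnedChain β γ hω hl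
  obtain ⟨s₂, hs₂, hV1⟩ := exists_isEvenPolyOfDegree_V_pinnedChain ω₂ lam γ hβ
  have hD : D.PreservesMeasure μ :=
    OscillatorChain.preservesMeasure_of_carrier_eq_bmGood hs₁ hs₂ hU1 hV1 D hcar hmeas hG hss
  induction hM using Submonoid.closure_induction with
  | mem o ho =>
    obtain ⟨u, hu, s, rfl⟩ := ho
    exact richMonomial_mem γ hω hl hβ hT D hcar hmeas hgrp μ hG hS hss hD hu s
  | one => exact richMonomial_one D μ
  | mul M₁ M₂ _ _ ih₁ ih₂ => exact richMonomial_mul D μ hD.2 ih₁ ih₂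

/-- **Orbits of multi-time monomials are continuous in time on the carrier**: for `M` in the monoid
generated by `{u ∘ φ_s}` and `σ ∈ D.carrier`, `t ↦ M(φ_t σ)` is continuous (generators:
`u(φ_s(φ_t σ)) = u(φ_{s+t} σ)` and `continuous_comp_flow_of_mem_polyObs`). [folklore] -/
theorem continuous_comp_flow_of_mem_closure (D : InfiniteChainDynamics P)
    (hgrp : ∀ t s : ℝ, D.flow (t + s) = D.flow t ∘ D.flow s) {M : ChainConfig → ℝ}
    (hM : M ∈ Submonoid.closure {w : (ℤ → ℝ × ℝ) → ℝ | ∃ u ∈ Algebra.adjoin ℝ (Set.range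
      fun xc : ℤ × Bool => fun σ : ChainConfig => if xc.2 then (σ xc.1).2 else (σ xc.1).1),
      ∃ s : ℝ, w = u ∘ D.flow s}) {σ : ChainConfig} (hσ : σ ∈ D.carrier) :
    Continuous fun t : ℝ => M (D.flow t σ) := by
  induction hM using Submonoid.closure_induction with
  | mem o ho =>
    obtain ⟨u, hu, s, rfl⟩ := ho
    have e : (fun t : ℝ => (u ∘ D.flow s) (D.flow t σ)) = (fun r : ℝ => u (D.flow r σ)) ∘ fun t : ℝ => s + t := by
      funext t
      simp only [comp_apply]
      rw [hgrp s t]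
      rfl
    rw [e]
    exact (continuous_comp_flow_of_mem_polyObs D hu hσ).comp (continuous_const.add continuous_id)
  | one => simp only [Pi.one_apply]; exact continuous_const
  | mul M₁ M₂ _ _ ih₁ ih₂ => simp only [Pi.mul_apply]; exact ih₁.mul ih₂

end Summit.AtomisticToContinuum.FouriersLaw.Theorems.DrudeDissolution.KineticPolymerGasOnTheTimeAxis

end
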